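import Summits.Ventures.CertifiedArithmetic.LowPrec.CompensatedEFT
import Summits.Ventures.CertifiedArithmetic.LowPrec.Exact
import Summits.Ventures.CertifiedArithmetic.LowPrec.AccumulateDirected

/-!
# GEMM inner products with exact products and compensated / truncated accumulation (R2, packaged)

HONEST FRAMING (venture CertifiedArithmetic / cell `pub-lowprec`): certified error envelopes and
provably optimal rounding/accumulation schemes for low-precision formats under stated cost models;
every table by two implementations; no hardware or vendor claims.

The cell's GEMM model (`pub-lowprec-gemm`, gemm.tex §Model): elements of two low-precision formats
`φ₁, φ₂`, products delivered EXACTLY in the accumulator format `α` (`Exact.lean`,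
`ExactInstances.lean`: every FP8/FP6/FP4 pair into `bfloat16`/`binary32`), then accumulated in `α`.
This file packages the accumulation theorems of `CompensatedSum.lean` / `CompensatedEFT.lean`
(Neumaier `kbn`, cascaded 2Sum `Sum2`) and `AccumulateDirected.lean` (truncation) as statements about
the inner product `Σ aᵢbᵢ` itself, parametric in an exactness hypothesis for the products, with the
FP8 → `binary32` / `bfloat16` instances; and it replays in the kernel the GEMM note's certified
worst cases for `kbn` (E2M1² → bfloat16, `W_kbn(3) = 1/289`, `W_kbn(4) = 1/257`) on the recorded
witnesses — the Lean evaluator as a further implementation on those rows.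
-/

namespace Literature.ComputerArithmetic.FloatingPoint

namespace MiniFloat

open Finset

variable {φ₁ φ₂ α : Format}

/-- COMPENSATED (Neumaier `kbn`) INNER PRODUCT with exact products: if every product `aᵢbᵢ` is a
value of the accumulator format `α` (`emaxCode ≥ 2`) and no chain sum leaves the range, then
`|res - Σ aᵢbᵢ| ≤ u·|Σ aᵢbᵢ| + n(n-1)·u²·Σ|aᵢbᵢ|` (`n + 1` products). [folklore] -/
theorem abs_kbnSum_dot_sub_le (hα : 2 ≤ α.emaxCode)
    (hexact : ∀ (a : MiniFloat φ₁) (b : MiniFloat φ₂), ∃ z : MiniFloat α, z.toRat = a.toRat * b.toRat)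
    (a : ℕ → MiniFloat φ₁) (b : ℕ → MiniFloat φ₂) (n : ℕ)
    (hr1 : ∀ k < n, |(kbn α (fun i => (a i).toRat * (b i).toRat) k).1
      + (a (k + 1)).toRat * (b (k + 1)).toRat| ≤ α.maxRat)
    (hr2 : ∀ k < n, |(kbn α (fun i => (a i).toRat * (b i).toRat) k).2
      + kbnCorr α (fun i => (a i).toRat * (b i).toRat) k| ≤ α.maxRat)
    (hr3 : |(kbn α (fun i => (a i).toRat * (b i).toRat) n).1
      + (kbn α (fun i => (a i).toRat * (b i).toRat) n).2| ≤ α.maxRat) :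
    |kbnSum α (fun i => (a i).toRat * (b i).toRat) n - ∑ i ∈ range (n + 1), (a i).toRat * (b i).toRat|
      ≤ α.unitRoundoff * |∑ i ∈ range (n + 1), (a i).toRat * (b i).toRat|
        + ((n : ℚ) * (n - 1)) * α.unitRoundoff ^ 2
          * ∑ i ∈ range (n + 1), |(a i).toRat * (b i).toRat| :=
  abs_kbnSum_sub_sum_le hα _ n (fun i _ => hexact (a i) (b i)) hr1 hr2 hr3

/-- BRANCH-FREE COMPENSATED (`Sum2`, cascaded 2Sum) INNER PRODUCT with exact products: same
envelope. [folklore] -/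
theorem abs_sum2_dot_sub_le (hα : 2 ≤ α.emaxCode)
    (hexact : ∀ (a : MiniFloat φ₁) (b : MiniFloat φ₂), ∃ z : MiniFloat α, z.toRat = a.toRat * b.toRat)
    (a : ℕ → MiniFloat φ₁) (b : ℕ → MiniFloat φ₂) (n : ℕ)
    (hr1 : ∀ k < n, |(compSum α (twoSumCorr α) (fun i => (a i).toRat * (b i).toRat) k).1
      + (a (k + 1)).toRat * (b (k + 1)).toRat| ≤ α.maxRat)
    (hr2 : ∀ k < n, |(compSum α (twoSumCorr α) (fun i => (a i).toRat * (b i).toRat) k).2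
      + twoSumCorr α (compSum α (twoSumCorr α) (fun i => (a i).toRat * (b i).toRat) k).1
          ((a (k + 1)).toRat * (b (k + 1)).toRat)| ≤ α.maxRat)
    (hr3 : |(compSum α (twoSumCorr α) (fun i => (a i).toRat * (b i).toRat) n).1
      + (compSum α (twoSumCorr α) (fun i => (a i).toRat * (b i).toRat) n).2| ≤ α.maxRat) :
    |compSumRes α (twoSumCorr α) (fun i => (a i).toRat * (b i).toRat) n
        - ∑ i ∈ range (n + 1), (a i).toRat * (b i).toRat|
      ≤ α.unitRoundoff * |∑ i ∈ range (n + 1), (a i).toRat * (b i).toRat|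
        + ((n : ℚ) * (n - 1)) * α.unitRoundoff ^ 2
          * ∑ i ∈ range (n + 1), |(a i).toRat * (b i).toRat| :=
  abs_sum2_sub_sum_le hα _ n (fun i _ => hexact (a i) (b i)) hr1 hr2 hr3

/-- TRUNCATED (round-toward-zero) recursive INNER PRODUCT with exact products: if every product is
a value of `α` and `Σ|aᵢbᵢ| ≤ maxRat α`, then `|ŝₙ - Σ aᵢbᵢ| ≤ 2u·n·Σ|aᵢbᵢ|` — every accumulator
format, nothing else assumed. [folklore] -/
theorem abs_seqSumWith_rz_dot_sub_le
    (hexact : ∀ (a : MiniFloat φ₁) (b : MiniFloat φ₂), ∃ z : MiniFloat α, z.toRat = a.toRat * b.toRat)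
    (a : ℕ → MiniFloat φ₁) (b : ℕ → MiniFloat φ₂) (n : ℕ)
    (hL : ∑ i ∈ range (n + 1), |(a i).toRat * (b i).toRat| ≤ α.maxRat) :
    |(seqSumWith (roundTowardZero α) (fun i => (a i).toRat * (b i).toRat) n).toRat
        - ∑ i ∈ range (n + 1), (a i).toRat * (b i).toRat|
      ≤ 2 * α.unitRoundoff * n * ∑ i ∈ range (n + 1), |(a i).toRat * (b i).toRat| :=
  (abs_seqSumWith_rz_sub_sum_le _ n (fun i _ => hexact (a i) (b i)) hL).2

/-! ### FP8 instances (products exact in the accumulator by `Exact.lean`) -/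

/-- `E4M3 × E4M3 → binary32`, compensated (`kbn`) accumulation. [folklore] -/
theorem E4M3_kbn_dot_Binary32 (a b : ℕ → MiniFloat Format.E4M3) (n : ℕ)
    (hr1 : ∀ k < n, |(kbn Format.Binary32 (fun i => (a i).toRat * (b i).toRat) k).1
      + (a (k + 1)).toRat * (b (k + 1)).toRat| ≤ Format.Binary32.maxRat)
    (hr2 : ∀ k < n, |(kbn Format.Binary32 (fun i => (a i).toRat * (b i).toRat) k).2
      + kbnCorr Format.Binary32 (fun i => (a i).toRat * (b i).toRat) k| ≤ Format.Binary32.maxRat)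
    (hr3 : |(kbn Format.Binary32 (fun i => (a i).toRat * (b i).toRat) n).1
      + (kbn Format.Binary32 (fun i => (a i).toRat * (b i).toRat) n).2| ≤ Format.Binary32.maxRat) :
    |kbnSum Format.Binary32 (fun i => (a i).toRat * (b i).toRat) n
        - ∑ i ∈ range (n + 1), (a i).toRat * (b i).toRat|
      ≤ Format.Binary32.unitRoundoff * |∑ i ∈ range (n + 1), (a i).toRat * (b i).toRat|
        + ((n : ℚ) * (n - 1)) * Format.Binary32.unitRoundoff ^ 2
          * ∑ i ∈ range (n + 1), |(a i).toRat * (b i).toRat| :=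
  abs_kbnSum_dot_sub_le (by decide) Format.E4M3_mul_E4M3_exact_in_Binary32 a b n hr1 hr2 hr3

/-- `E5M2 × E5M2 → bfloat16`, compensated (`kbn`) accumulation. [folklore] -/
theorem E5M2_kbn_dot_BFloat16 (a b : ℕ → MiniFloat Format.E5M2) (n : ℕ)
    (hr1 : ∀ k < n, |(kbn Format.BFloat16 (fun i => (a i).toRat * (b i).toRat) k).1
      + (a (k + 1)).toRat * (b (k + 1)).toRat| ≤ Format.BFloat16.maxRat)
    (hr2 : ∀ k < n, |(kbn Format.BFloat16 (fun i => (a i).toRat * (b i).toRat) k).2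
      + kbnCorr Format.BFloat16 (fun i => (a i).toRat * (b i).toRat) k| ≤ Format.BFloat16.maxRat)
    (hr3 : |(kbn Format.BFloat16 (fun i => (a i).toRat * (b i).toRat) n).1
      + (kbn Format.BFloat16 (fun i => (a i).toRat * (b i).toRat) n).2| ≤ Format.BFloat16.maxRat) :
    |kbnSum Format.BFloat16 (fun i => (a i).toRat * (b i).toRat) n
        - ∑ i ∈ range (n + 1), (a i).toRat * (b i).toRat|
      ≤ Format.BFloat16.unitRoundoff * |∑ i ∈ range (n + 1), (a i).toRat * (b i).toRat|
        + ((n : ℚ) * (n - 1)) * Format.BFloat16.unitRoundoff ^ 2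
          * ∑ i ∈ range (n + 1), |(a i).toRat * (b i).toRat| :=
  abs_kbnSum_dot_sub_le (by decide) Format.E5M2_mul_E5M2_exact_in_BFloat16 a b n hr1 hr2 hr3

/-- `E4M3 × E5M2 → binary32`, truncated accumulation: `|ŝₙ - Σaᵢbᵢ| ≤ 2u·n·Σ|aᵢbᵢ|` whenever
`Σ|aᵢbᵢ| ≤ maxRat`. [folklore] -/
theorem E4M3_E5M2_rz_dot_Binary32 (a : ℕ → MiniFloat Format.E4M3) (b : ℕ → MiniFloat Format.E5M2)
    (n : ℕ) (hL : ∑ i ∈ range (n + 1), |(a i).toRat * (b i).toRat| ≤ Format.Binary32.maxRat) :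
    |(seqSumWith (roundTowardZero Format.Binary32) (fun i => (a i).toRat * (b i).toRat) n).toRat
        - ∑ i ∈ range (n + 1), (a i).toRat * (b i).toRat|
      ≤ 2 * Format.Binary32.unitRoundoff * n * ∑ i ∈ range (n + 1), |(a i).toRat * (b i).toRat| :=
  abs_seqSumWith_rz_dot_sub_le Format.E4M3_mul_E5M2_exact_in_Binary32 a b n hL

/-! ### Kernel replay of the GEMM note's certified `kbn` worst cases (E2M1² → bfloat16, RNE) -/

/-- The GEMM note's witnesses (products of `E2M1` values, accumulated in `bfloat16` by `kbn`):
`(¼, -36, -36)`: `res = -72` against the exact `-71.75` (error `¼`, `Σ|pᵢ| = 72.25`, ratio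
`1/289 = W_kbn(3)`); `(¼, 4, 24, 36)`: `res = 64` against `64.25` (error `¼`, `Σ|pᵢ| = 64.25`, ratio
`1/257 = W_kbn(4)`) — the certified maxima of GEMM-BOUNDS (two implementations) are reproduced on
their witnesses by the Lean definitions. [folklore] -/
theorem kbn_gemm_witnesses_BFloat16 :
    kbnSum Format.BFloat16 (fun i => if i = 0 then 1 / 4 else -36) 2 = -72 ∧
    kbnSum Format.BFloat16 (fun i => [1 / 4, 4, 24, 36].getD i 0) 3 = 64 := by
  decide +kernel

end MiniFloat

end Literature.ComputerArithmetic.FloatingPoint
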